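import Summits.QuantumAdvantage.AdviceFreeQNC0.AffBells23AntipodalFold
import Summits.QuantumAdvantage.AdviceFreeQNC0.AffBells23AntipodalTransfer
import HarnessLib

/-!
# The antipodal 2-junta, step (ii)(b) and the assembly of ask P-23h: **`antipodalValueFormula : AntipodalValueFormula`** —
# `4·wins(N) = 2^N + a_{N/2} − (−2)^{N/2} − b_{N/2}` for every even `N ≥ 6` (planner qn-p1 g23, ROUND-22 §2.8)

Assembly (prover seat qn-prover-3 g13) of

* (i) `antipodal_rel_iff` (`AffBells23AntipodalWin.lean`): on the odd class, WIN ⟺ `stat(x, J(x))` odd;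
* (ii)(a) `configSum_eq_powSum` (`AffBells23AntipodalFold.lean` + `CyclicTransfer.lean`): the configuration sums
  `C_± = Σ_{x,v} [v ∈ K(x)]·twist_±(x)·(−1)^{stat(x,v)}` are entry sums of the `(N/2)`-th power of the pair-state matrix;
* (ii)(b) here: the pair-state matrices ARE the tables `Mp1` / `Mm1` (`M_G_false_eq`, `M_G_true_eq`, by `decide`), powers commute
  with the re-indexing (`submatrix_pow_eq`), and the entry sum is the swap-trace (`powSum_eq_trSwap`), so `C_+ = tr_σ(M₊^{N/2})`,
  `C_− = tr_σ(M₋^{N/2})`;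
* (iii) `trSwap_Mp_pow`, `trSwap_Mm_pow` (`AffBells23AntipodalTransfer.lean`): `tr_σ(M₊^h) = 4^h + b_h`, `tr_σ(M₋^h) = a_h − (−2)^h`;
* the odd-class reduction: `C_+ − C_− = 2 Σ_{x odd} Σ_{v ∈ K(x)} (−1)^{stat} = 2 Σ_{x odd} (1 + (−1)^{stat(x,J(x))})` (the kernel of an
  odd input is `{0, J(x)}`, `Fib19.kline_eq_iff_inKernel`) `= 2(2^N − 2·wins)`.

Hence `4·wins = 2·2^N − C_+ + C_− = 2^N + a_{N/2} − (−2)^{N/2} − b_{N/2}`: **`antipodalValueFormula`** — the planner's closed form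
(`AffBells23NearPerfect.AntipodalValueFormula`, numerically verified by them for `N ≤ 40`) is a TREE THEOREM; the first exactly solved
dense-residual family of the (G2) regime.
WHAT THIS IS NOT: the corollary `≤ 3/4` from `N = 8` (`AntipodalLeThreeQuartersFrom8`) is not derived here; instrument for crux
stmt-QuantumAdvantage-22907 (route DWalkThree); separation NOT moved.
-/

namespace Summit.QuantumAdvantage.AdviceFreeQNC0

namespace AffBells23

open Finset Matrix Literature.Computability.QuantumComplexity Literature.Computability.QuantumComplexity.RingHLF
open CyclicTransfer Fib19

/-! ### The pair-state matrices are the tables -/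

/-- Pair states `((v_{t−1}, v_{t+h−1}), (v_t, v_{t+h}))`. -/
abbrev Q := (Bool × Bool) × (Bool × Bool)

/-- The table index `8a + 4b + 2c + d` of the pair state `((a, c), (b, d))` (planner's state `(v_{t−1}, v_t; v_{t+h−1}, v_{t+h})`). -/
def code (p : Q) : ℕ := 8 * p.1.1.toNat + 4 * p.2.1.toNat + 2 * p.1.2.toNat + p.2.2.toNat

/-- The code is a table index. -/
theorem code_lt (p : Q) : code p < 16 := by
  rcases p with ⟨⟨a, c⟩, ⟨b, d⟩⟩
  cases a <;> cases b <;> cases c <;> cases d <;> decide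

/-- The encoding of pair states as table indices. -/
def enc (p : Q) : Fin 16 := ⟨code p, code_lt p⟩

/-- The encoding is a bijection. -/
theorem enc_bijective : Function.Bijective enc := by decide

/-- The encoding as an equivalence. -/
noncomputable def encEquiv : Q ≃ Fin 16 := Equiv.ofBijective enc enc_bijective

/-- **The plain pair-state matrix is the table `Mp1`.** -/
theorem M_G_false_eq : ∀ p q : Q, M (G false) p q = Mp1 (enc p) (enc q) := by decide +kernel

/-- **The twisted pair-state matrix is the table `Mm1`.** -/
theorem M_G_true_eq : ∀ p q : Q, M (G true) p q = Mm1 (enc p) (enc q) := by decide +kernel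

/-- The pair-state matrix as a re-indexed table. -/
theorem M_G_eq_submatrix (minus : Bool) :
    M (G minus) = (if minus then Mm1 else Mp1).submatrix encEquiv encEquiv := by
  ext p q
  rw [Matrix.submatrix_apply]
  cases minus
  · exact M_G_false_eq p q
  · exact M_G_true_eq p q

/-- Powers commute with re-indexing along an equivalence. -/
theorem submatrix_pow_eq (A : Matrix (Fin 16) (Fin 16) ℤ) (e : Q ≃ Fin 16) :
    ∀ k : ℕ, (A.submatrix e e) ^ k = (A ^ k).submatrix e e
  | 0 => by rw [pow_zero, pow_zero, Matrix.submatrix_one_equiv]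
  | k + 1 => by rw [pow_succ, submatrix_pow_eq A e k, Matrix.submatrix_mul_equiv, ← pow_succ]

/-- Re-indexing the closing pairs: `(b, c) ↦ enc (swap c, b)`. -/
def closeIdx (bc : (Bool × Bool) × (Bool × Bool)) : Fin 16 := enc (Prod.swap bc.2, bc.1)

/-- `closeIdx` is a bijection. -/
theorem closeIdx_bijective : Function.Bijective closeIdx := by decide

/-- The partner of a closing pair is its half-turn swap. -/
theorem enc_close_swap : ∀ bc : (Bool × Bool) × (Bool × Bool),
    enc (bc.2, Prod.swap bc.1) = swapIdx (closeIdx bc) := by decide +kernel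

/-- **The closing entry sum is the swap-trace.** -/
theorem powSum_eq_trSwap (minus : Bool) (k : ℕ) :
    ∑ b : Bool × Bool, ∑ c : Bool × Bool, (M (G minus) ^ k) (Prod.swap c, b) (c, Prod.swap b) =
      trSwap ((if minus then Mm1 else Mp1) ^ k) := by
  rw [M_G_eq_submatrix, submatrix_pow_eq]
  unfold trSwap
  rw [← Fintype.sum_prod_type' (fun b c => ((if minus then Mm1 else Mp1) ^ k).submatrix encEquiv encEquiv
    (Prod.swap c, b) (c, Prod.swap b))]
  refine Fintype.sum_bijective closeIdx closeIdx_bijective _ _ fun bc => ?_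
  rw [Matrix.submatrix_apply, ← enc_close_swap bc]
  rfl

/-- **Step (ii): the configuration sums are the swap-traces of the table powers.** -/
theorem configSum_eq_trSwap (minus : Bool) (n : ℕ) :
    ∑ x : Fin ((n + 2) + (n + 2)) → Bool, ∑ v : Fin ((n + 2) + (n + 2)) → Bool, configW minus x v =
      trSwap ((if minus then Mm1 else Mp1) ^ (n + 2)) := by
  rw [configSum_eq_powSum, powSum_eq_trSwap]

/-! ### The odd-class reduction -/

variable {n : ℕ}

/-- The plain twist is trivial. -/
theorem prod_twist_false (x : Fin ((n + 2) + (n + 2)) → Bool) : (∏ b, twist false (x b)) = 1 :=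
  Finset.prod_eq_one fun b _ => by unfold twist; rfl

/-- The signed twist is `(−1)^{#zeros}`. -/
theorem prod_twist_true (x : Fin ((n + 2) + (n + 2)) → Bool) :
    (∏ b, twist true (x b)) = (-1) ^ (univ.filter fun b => x b = false).card := by
  rw [← Finset.prod_const, Finset.prod_filter]
  refine Finset.prod_congr rfl fun b _ => ?_
  unfold twist
  cases x b <;> simp

/-- `1 − (−1)^{#zeros} = 2·[#zeros odd]`. -/
theorem one_sub_neg_one_pow (k : ℕ) : (1 : ℤ) - (-1) ^ k = if k % 2 = 1 then 2 else 0 := by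
  rcases Nat.even_or_odd k with hk | hk
  · rw [hk.neg_one_pow, if_neg (by rcases hk with ⟨m, rfl⟩; omega)]; ring
  · rw [hk.neg_one_pow, if_pos (by rcases hk with ⟨m, rfl⟩; omega)]; ring

/-- `(−1)^k = 1 − 2·[k odd]`. -/
theorem neg_one_pow_eq (k : ℕ) : ((-1 : ℤ)) ^ k = 1 - (if k % 2 = 1 then 2 else 0) := by
  have := one_sub_neg_one_pow k
  linarith

/-- The zero vector is in every ring kernel. -/
theorem inKernel_zero {N : ℕ} (x : Fin N → Bool) : InKernel x (fun _ => false) := by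
  intro b; simp

/-- The antipodal statistic of the zero vector vanishes. -/
theorem stat_zero (x : Fin ((n + 2) + (n + 2)) → Bool) : stat x (fun _ => false) = 0 := by
  unfold stat
  rw [Finset.card_eq_zero, Finset.filter_eq_empty_iff]
  intro t _ h
  exact h.2 rfl

/-- **The kernel of an odd input is `{0, J(x)}`**: the kernel sum of any function is `f 0 + f J(x)`. -/
theorem sum_inKernel_eq (x : Fin ((n + 2) + (n + 2)) → Bool) (hx : OddZeros x) (f : (Fin ((n + 2) + (n + 2)) → Bool) → ℤ) :
    ∑ v, (if InKernel x v then (1 : ℤ) else 0) * f v = f (fun _ => false) + f (kline x) := by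
  classical
  have hN : 3 ≤ (n + 2) + (n + 2) := by omega
  have hodd : IsOdd x := (isOdd_iff_oddZeros x).2 hx
  have hne : (fun _ => false) ≠ kline x := fun h => kline_ne_zero hN x hodd h.symm
  have hfilter : (univ.filter fun v => InKernel x v) = {fun _ => false, kline x} := by
    ext v
    simp only [mem_filter, mem_univ, true_and, mem_insert, mem_singleton]
    constructor
    · intro hv
      by_cases h0 : v = fun _ => false
      · exact Or.inl h0
      · exact Or.inr ((kline_eq_iff_inKernel hN x hodd h0).2 hv).symm
    · rintro (rfl | rfl)
      · exact inKernel_zero x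
      · exact kline_inKernel hN x hodd
  have e : ∀ v, (if InKernel x v then (1 : ℤ) else 0) * f v = if InKernel x v then f v else 0 := by
    intro v; split_ifs <;> ring
  simp_rw [e]
  rw [← Finset.sum_filter, hfilter, Finset.sum_pair hne]

open scoped Classical in
/-- **The difference of the two configuration sums counts the odd class**:
`C_+ − C_− = 2·#odd + 2·Σ_{x odd} (−1)^{stat(x, J(x))}`. -/
theorem configSum_diff (n : ℕ) :
    (∑ x : Fin ((n + 2) + (n + 2)) → Bool, ∑ v, configW false x v) - (∑ x : Fin ((n + 2) + (n + 2)) → Bool, ∑ v, configW true x v) =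
      ∑ x ∈ univ.filter (fun x : Fin ((n + 2) + (n + 2)) → Bool => OddZeros x), (2 + 2 * (-1) ^ stat x (kline x)) := by
  rw [← Finset.sum_sub_distrib, Finset.sum_filter]
  refine Finset.sum_congr rfl fun x _ => ?_
  rw [← Finset.sum_sub_distrib]
  have e : ∀ v, configW false x v - configW true x v =
      (if (univ.filter fun b => x b = false).card % 2 = 1 then 2 else 0) *
        ((if InKernel x v then (1 : ℤ) else 0) * (-1) ^ stat x v) := by
    intro v
    unfold configW
    rw [prod_twist_false, prod_twist_true, ← one_sub_neg_one_pow]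
    ring
  simp_rw [e]
  rw [← Finset.mul_sum]
  by_cases hx : OddZeros x
  · have hx' : (univ.filter fun b => x b = false).card % 2 = 1 := hx
    rw [if_pos hx', if_pos hx, sum_inKernel_eq x hx, stat_zero, pow_zero]
    ring
  · have hx' : ¬ (univ.filter fun b => x b = false).card % 2 = 1 := hx
    rw [if_neg hx', if_neg hx, zero_mul]

open scoped Classical in
/-- **The signed count on the odd class in terms of the win count.** -/
theorem sum_sign_eq (n : ℕ) :
    ∑ x ∈ univ.filter (fun x : Fin ((n + 2) + (n + 2)) → Bool => OddZeros x), ((-1 : ℤ)) ^ stat x (kline x) =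
      (2 : ℤ) ^ ((n + 2) + (n + 2) - 1) - 2 * (affWinCard (antipodalRows ((n + 2) + (n + 2))) (fun _ => (1 : ZMod 3)) : ℤ) := by
  classical
  have hodd : ((univ.filter fun x : Fin ((n + 2) + (n + 2)) → Bool => OddZeros x).card : ℤ) =
      (2 : ℤ) ^ ((n + 2) + (n + 2) - 1) := by
    have h := card_isOdd (n := (n + 2) + (n + 2)) (by omega)
    rw [filter_congr fun x _ => isOdd_iff_oddZeros x] at h
    exact_mod_cast h
  have hwin : (affWinCard (antipodalRows ((n + 2) + (n + 2))) (fun _ => (1 : ZMod 3)) : ℤ) =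
      ∑ x ∈ univ.filter (fun x : Fin ((n + 2) + (n + 2)) → Bool => OddZeros x),
        (if stat x (kline x) % 2 = 1 then (1 : ℤ) else 0) := by
    unfold affWinCard
    rw [Finset.sum_boole, ← Finset.filter_filter]
    congr 1
    apply congrArg
    ext x
    simp only [mem_filter, mem_univ, true_and]
    constructor
    · rintro ⟨hx, hr⟩
      exact ⟨hx, (antipodal_rel_iff (by omega) x hx).1 hr⟩
    · rintro ⟨hx, hs⟩
      exact ⟨hx, (antipodal_rel_iff (by omega) x hx).2 hs⟩
  simp_rw [neg_one_pow_eq]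
  rw [Finset.sum_sub_distrib, Finset.sum_const, nsmul_eq_mul, mul_one, hodd, hwin, Finset.mul_sum]
  congr 1
  refine Finset.sum_congr rfl fun x _ => ?_
  split_ifs <;> ring

open scoped Classical in
/-- **The value formula on the cycle of length `h + h`, `h = n + 2`.** -/
theorem antipodal_value (n : ℕ) :
    4 * (affWinCard (antipodalRows ((n + 2) + (n + 2))) (fun _ => (1 : ZMod 3)) : ℤ) =
      4 ^ (n + 2) + luc32 (n + 2) - (-2) ^ (n + 2) - luc14 (n + 2) := by
  have hdiff := configSum_diff n
  rw [configSum_eq_trSwap, configSum_eq_trSwap] at hdiff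
  simp only [if_true] at hdiff
  rw [show ((if false then Mm1 else Mp1) : Matrix (Fin 16) (Fin 16) ℤ) = Mp1 from rfl,
    trSwap_Mp_pow (n + 2) (by omega), trSwap_Mm_pow (n + 2) (by omega),
    Finset.sum_add_distrib, Finset.sum_const, nsmul_eq_mul, ← Finset.mul_sum, sum_sign_eq] at hdiff
  have hodd : (((univ.filter fun x : Fin ((n + 2) + (n + 2)) → Bool => OddZeros x).card : ℤ)) =
      (2 : ℤ) ^ ((n + 2) + (n + 2) - 1) := by
    classical
    have h := card_isOdd (n := (n + 2) + (n + 2)) (by omega)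
    rw [filter_congr fun x _ => isOdd_iff_oddZeros x] at h
    exact_mod_cast h
  rw [hodd] at hdiff
  have hpow : (4 : ℤ) ^ (n + 2) = 2 * 2 ^ ((n + 2) + (n + 2) - 1) := by
    rw [show (4 : ℤ) = 2 ^ 2 by norm_num, ← pow_mul,
      show 2 * (n + 2) = ((n + 2) + (n + 2) - 1) + 1 by omega, pow_succ]
    ring
  linarith

/-- **`AntipodalValueFormula` — PROVED** (every even `N ≥ 6`; in fact every even `N ≥ 4`). -/
theorem antipodalValueFormula : AntipodalValueFormula := by
  intro N h6 heven
  obtain ⟨n, rfl⟩ : ∃ n, N = (n + 2) + (n + 2) := ⟨N / 2 - 2, by omega⟩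
  have hh : ((n + 2) + (n + 2)) / 2 = n + 2 := by omega
  rw [hh, antipodal_value n]
  congr 1
  congr 1
  congr 1
  rw [show (4 : ℤ) = 2 ^ 2 by norm_num, ← pow_mul]
  congr 1
  omega

end AffBells23

end Summit.QuantumAdvantage.AdviceFreeQNC0
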